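import Literature.AlgebraicGeometry.Resolution.RidgeCone
import Literature.AlgebraicGeometry.Resolution.AdditiveFormsStructure
import Literature.AlgebraicGeometry.Resolution.PointBlowupRidge
import Literature.RingTheory.MvPolynomial.IdealNormalForm
import HarnessLib

/-!
# Giraud's structure theorem: the ideal of the ridge is generated by additive homogeneous polynomials — PROOF of the
# named fact `RidgeIdealSpanAdditive` (Giraud 1975 §1.5; Berthomieu–Hivert–Mourtada 2010 Lemma 2.6/2.7, Cor. 2.12)

Topic: `Literature/AlgebraicGeometry/Resolution`. `PointBlowupRidge.lean` records as a NAMED FACT («Not proved in the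
tree») Giraud's theorem on the ridge (faîte) `F` of the cone `C = V(I)` of a homogeneous ideal
`I ⊆ S = K[X_1, …, X_n]`:

> **Giraud 1975, §1.5.** "Ce foncteur est représentable par un sous-schéma en groupes fermé de `V`, qui est aussi un
> cône, autrement dit, `F` admet pour équations des polynômes additifs homogènes."
> **BHM 2010, Lemma 2.6 / 2.7, Cor. 2.12.** the ideal of the ridge is generated by additive polynomials
> `Σ λ_i X_i^{p^{r_i}}` (Def. 1.2), homogeneous ones having a single exponent.

`RidgeIdealSpanAdditive p I : Prop := ridgeIdeal I = Ideal.span (Set.range (ridgeForm p I))` — the ideal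
`𝔉 = ridgeIdeal I` of the ridge is generated by the additive homogeneous `p`-forms `Σ_k c_k X_k^{p^e}` it contains.
This file PROVES it for every HOMOGENEOUS ideal `I` over a field `K` of exponential characteristic `p`
(`ridgeIdealSpanAdditive_of_isHomogeneous`; the hypotheses are necessary: for `I = (X² + X)` in characteristic `2`
the ridge ideal `(X² + X)` contains no nonzero `p`-form, and `p` must be the exponential characteristic). Proof:

1. **`𝔉` is a Hopf ideal** (`taylor_mem_of_mem_ridgeIdeal`): `g(x + u) ∈ 𝔉(x)S[u] + 𝔉(u)S[u]` for `g ∈ 𝔉` — the two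
   tautological points `x̄`, `ū` of `F` over `S[u]/(𝔉(x) + 𝔉(u))` lie in the ridge by representability
   (`mem_ridge_iff_forall_ridgeIdeal`, `RidgeRepresentable.lean`), hence so does their sum (`ridge` is a submonoid).
2. **`𝔉` is homogeneous** (`homogeneousComponent_mem_ridgeIdeal`, `RidgeCone.lean`).
3. **Gröbner normal forms** (`IdealNormalForm.lean`, CLO Ch. 5 §3 Prop. 1 / Ch. 2 §7 Thm. 5): fix a monomial order;
   for a minimal generator `x^M` of `⟨LT(𝔉)⟩` the reduced Gröbner generator `g = x^M − NF(x^M) ∈ 𝔉` is a monic form of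
   degree `d = |M|` whose other monomials are standard. Applying the `S`-linear "normal form in the outer variables"
   `u^A ↦ NF(x^A)(u)` — which kills `𝔉(u)S[u]` and preserves `𝔉(x)S[u]` — to `g(x + u) = Σ_A D_A g(x) u^A` gives
   (`hasseDeriv_sub_C_coeff_mem`) **`D_A g − coeff_A(g) ∈ 𝔉` for every `A`**, because every `u^A` occurring with
   `A ≠ M` is standard (it divides a standard monomial of `g`, or properly divides `x^M`) and `D_M g = 1`.
4. For `0 < |A| < d`, `D_A g` is supported on standard monomials and lies in `𝔉`, so **`D_A g = 0`**
   (`hasseDeriv_reducedGen_eq_zero`); by `AdditiveFormsStructure.lean` (Schober Rem. 2.6 in Hasse form), `g` is a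
   `p`-form `Σ_k c_k X_k^{p^e}`, `d = p^e` (`exists_reducedGen_eq_ridgeForm`).
5. The reduced Gröbner generators generate `𝔉` (`le_of_forall_reducedGen_mem`).

Consequences recorded: `ridgeIdeal_eq_span_isAdditive` (𝔉 is generated by its additive homogeneous elements, index-free
form) and the discharge `ridgeIdealSpanAdditive_of_isHomogeneous` / `…_of_isHomogeneousIdeal`-style corollaries for
`CharP`/`CharZero`. Written by the cell res-hironaka (seat res-L1-s46-pv-7, W4.6 rung (iv): in the TAME regime the
generators are LINEAR, `PrincipalRidgeLinearTame.lean`; this file is the all-characteristic structure theorem behind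
Hironaka's edge datum `ridgeEdgeInv`). AI-written; AI review is weaker than expert review.

## References

* J. Giraud, *Contact maximal en caractéristique positive*, Ann. Sci. ÉNS (4) 8 (1975) 201–234, §1.5, Lemme 1.6–1.7.
  [Giraud1975]
* J. Berthomieu, P. Hivert, H. Mourtada, *Computing Hironaka's invariants: ridge and directrix*, Contemp. Math. 521
  (2010), Def. 1.2, Prop.–Def. 2.1, Lemma 2.6, Lemma 2.7, Cor. 2.12. [BerthomieuHivertMourtada2010]
* H. Hironaka, *Additive groups associated with points of a projective space*, Ann. of Math. 92 (1970) 327–334.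
  [Hironaka1970AdditiveGroups]
* D. Cox, J. Little, D. O'Shea, *Ideals, Varieties, and Algorithms*, 3rd ed. (2007), Ch. 2 §7 Thm. 5, Ch. 5 §3 Prop. 1.
  [CoxLittleOShea2007]
-/

noncomputable section

open MvPolynomial
open scoped MonomialOrder

namespace Literature.AlgebraicGeometry.Resolution

open Literature.RingTheory.MvPolynomial.IdealNormalForm
open Literature.RingTheory.MvPolynomial.BuchbergerCriterion (IsReduced)

universe u

variable {K : Type u} [Field K] {n : ℕ} {I : Ideal (MvPolynomial (Fin n) K)}

/-! ## 1. The ideal of the ridge is a Hopf ideal -/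

section Hopf

/-- **`𝔉` is a Hopf ideal of `S = K[x]`**: for `g ∈ 𝔉 = ridgeIdeal I`, the Taylor expansion `g(x + u) ∈ S[u]` lies in
`𝔉·S[u] + 𝔉(u)·S[u]` (the comorphism of the group law maps `𝔉` into `𝔉 ⊗ S + S ⊗ 𝔉`: `F = V(𝔉)` is a subgroup
scheme of the vector group). Proof: the tautological points `x̄` and `ū` over `S[u]/(𝔉·S[u] + 𝔉(u)·S[u])` are
points of the ridge by representability, hence so is `x̄ + ū`. [cite: Giraud1975, §1.5]
[cite: BerthomieuHivertMourtada2010, Prop. 2.1] -/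
theorem taylor_mem_of_mem_ridgeIdeal {g : MvPolynomial (Fin n) K} (hg : g ∈ ridgeIdeal I) :
    taylor K g ∈ (ridgeIdeal I).map (C : MvPolynomial (Fin n) K →+* MvPolynomial (Fin n) (MvPolynomial (Fin n) K)) ⊔
      (ridgeIdeal I).map (MvPolynomial.map (C : K →+* MvPolynomial (Fin n) K)) := by
  set J := (ridgeIdeal I).map (C : MvPolynomial (Fin n) K →+* MvPolynomial (Fin n) (MvPolynomial (Fin n) K)) ⊔
      (ridgeIdeal I).map (MvPolynomial.map (C : K →+* MvPolynomial (Fin n) K)) with hJ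
  let π : MvPolynomial (Fin n) (MvPolynomial (Fin n) K) →ₐ[K] MvPolynomial (Fin n) (MvPolynomial (Fin n) K) ⧸ J :=
    Ideal.Quotient.mkₐ K J
  -- the point `x̄`
  have hx : (fun j => π (C (X j))) ∈ ridge (MvPolynomial (Fin n) (MvPolynomial (Fin n) K) ⧸ J) I := by
    rw [mem_ridge_iff_forall_ridgeIdeal]
    intro g' hg'
    have hcomp : (aeval fun j => π (C (X j : MvPolynomial (Fin n) K))) =
        π.comp (IsScalarTower.toAlgHom K (MvPolynomial (Fin n) K) (MvPolynomial (Fin n) (MvPolynomial (Fin n) K))) :=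
      MvPolynomial.algHom_ext fun j => by
        rw [aeval_X, AlgHom.comp_apply, IsScalarTower.toAlgHom_apply, MvPolynomial.algebraMap_eq]
    rw [hcomp, AlgHom.comp_apply, IsScalarTower.toAlgHom_apply, MvPolynomial.algebraMap_eq]
    exact (Ideal.Quotient.eq_zero_iff_mem).mpr (Ideal.mem_sup_left (Ideal.mem_map_of_mem _ hg'))
  -- the point `ū`
  have hu : (fun j => π (X j)) ∈ ridge (MvPolynomial (Fin n) (MvPolynomial (Fin n) K) ⧸ J) I := by
    rw [mem_ridge_iff_forall_ridgeIdeal]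
    intro g' hg'
    have hcomp : (aeval fun j => π (X j : MvPolynomial (Fin n) (MvPolynomial (Fin n) K))) =
        π.comp (mapAlgHom (Algebra.ofId K (MvPolynomial (Fin n) K))) :=
      MvPolynomial.algHom_ext fun j => by rw [aeval_X, AlgHom.comp_apply, mapAlgHom_apply, map_X]
    rw [hcomp, AlgHom.comp_apply, mapAlgHom_apply]
    refine (Ideal.Quotient.eq_zero_iff_mem).mpr (Ideal.mem_sup_right ?_)
    have hC : (↑(Algebra.ofId K (MvPolynomial (Fin n) K)) : K →+* MvPolynomial (Fin n) K) = C :=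
      RingHom.ext fun c => by simp [MvPolynomial.algebraMap_eq]
    rw [hC]
    exact Ideal.mem_map_of_mem _ hg'
  -- their sum is a point of the ridge at which `g` vanishes, i.e. `g(x + u) ∈ J`
  have h0 := hg _ _ ((ridge _ I).add_mem hx hu)
  have hcomp : (aeval ((fun j => π (C (X j : MvPolynomial (Fin n) K))) + fun j => π (X j))) = π.comp (taylor K) :=
    MvPolynomial.algHom_ext fun j => by rw [aeval_X, AlgHom.comp_apply, taylor_X, map_add, Pi.add_apply]
  rw [hcomp, AlgHom.comp_apply] at h0
  exact (Ideal.Quotient.eq_zero_iff_mem).mp h0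

end Hopf

/-! ## 2. The normal form in the outer variables -/

section OuterNormalForm

variable (m : MonomialOrder (Fin n)) (J : Ideal (MvPolynomial (Fin n) K))

/-- **The normal form in the outer variables**: an `S`-linear endomorphism `Φ` of `S[u]` with `c u^A ↦ c · NF(x^A)(u)`
(`NF` the normal form modulo `J` for the monomial order `m`) exists — extend linearly from the monomial basis. [folklore] -/
private theorem exists_outerNF :
    ∃ Φ : MvPolynomial (Fin n) (MvPolynomial (Fin n) K) →ₗ[MvPolynomial (Fin n) K]
        MvPolynomial (Fin n) (MvPolynomial (Fin n) K),
      ∀ (A : Fin n →₀ ℕ) (c : MvPolynomial (Fin n) K), Φ (monomial A c) =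
        c • MvPolynomial.map (C : K →+* MvPolynomial (Fin n) K) (normalForm m J (monomial A 1)) := by
  refine ⟨(MvPolynomial.basisMonomials (Fin n) (MvPolynomial (Fin n) K)).constr (MvPolynomial (Fin n) K)
    fun A => MvPolynomial.map (C : K →+* MvPolynomial (Fin n) K) (normalForm m J (monomial A 1)), fun A c => ?_⟩
  have h1 : (monomial A c : MvPolynomial (Fin n) (MvPolynomial (Fin n) K)) =
      c • MvPolynomial.basisMonomials (Fin n) (MvPolynomial (Fin n) K) A := by
    rw [coe_basisMonomials, smul_monomial, smul_eq_mul, mul_one]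
  rw [h1, map_smul, Module.Basis.constr_basis]

variable {m J}
variable {Φ : MvPolynomial (Fin n) (MvPolynomial (Fin n) K) →ₗ[MvPolynomial (Fin n) K]
    MvPolynomial (Fin n) (MvPolynomial (Fin n) K)}
  (hΦ : ∀ (A : Fin n →₀ ℕ) (c : MvPolynomial (Fin n) K), Φ (monomial A c) =
    c • MvPolynomial.map (C : K →+* MvPolynomial (Fin n) K) (normalForm m J (monomial A 1)))
include hΦ

/-- Value of the outer normal form on a general element: `Σ_A c_A u^A ↦ Σ_A c_A NF(x^A)(u)`. [folklore] -/
private theorem outerNF_eq_sum (F : MvPolynomial (Fin n) (MvPolynomial (Fin n) K)) :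
    Φ F = ∑ A ∈ F.support,
      coeff A F • MvPolynomial.map (C : K →+* MvPolynomial (Fin n) K) (normalForm m J (monomial A 1)) := by
  conv_lhs => rw [F.as_sum, map_sum]
  exact Finset.sum_congr rfl fun A _ => hΦ A _

omit hΦ in
/-- `(c q)(u) = c · q(u)` for a scalar `c ∈ K`. [folklore] -/
private theorem map_C_smul (c : K) (q : MvPolynomial (Fin n) K) :
    MvPolynomial.map (C : K →+* MvPolynomial (Fin n) K) (c • q) =
      (C c : MvPolynomial (Fin n) K) • MvPolynomial.map (C : K →+* MvPolynomial (Fin n) K) q := by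
  rw [smul_eq_C_mul, map_mul, map_C, smul_eq_C_mul]

/-- On `q(u)` the outer normal form is `NF(q)(u)`. [folklore] -/
private theorem outerNF_map (q : MvPolynomial (Fin n) K) :
    Φ (MvPolynomial.map (C : K →+* MvPolynomial (Fin n) K) q) =
      MvPolynomial.map (C : K →+* MvPolynomial (Fin n) K) (normalForm m J q) := by
  conv_lhs => rw [q.as_sum, map_sum, map_sum]
  conv_rhs => rw [q.as_sum, normalForm_sum, map_sum]
  refine Finset.sum_congr rfl fun A _ => ?_
  rw [map_monomial, hΦ, ← map_C_smul, ← normalForm_smul, smul_monomial, smul_eq_mul, mul_one]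

/-- **The outer normal form kills `J(u)·S[u]`.** [folklore] -/
private theorem outerNF_eq_zero_of_mem {F : MvPolynomial (Fin n) (MvPolynomial (Fin n) K)}
    (hF : F ∈ J.map (MvPolynomial.map (C : K →+* MvPolynomial (Fin n) K))) : Φ F = 0 := by
  -- the stronger statement `∀ t, Φ (t * F) = 0` is stable under the ideal operations
  suffices H : ∀ t : MvPolynomial (Fin n) (MvPolynomial (Fin n) K), Φ (t * F) = 0 by
    simpa using H 1
  rw [Ideal.map] at hF
  refine Submodule.span_induction ?_ ?_ ?_ ?_ hF
  · rintro _ ⟨q, hq, rfl⟩ t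
    -- `t · q(u) = Σ_B t_B · (x^B q)(u)` and `NF(x^B q) = 0`
    rw [t.as_sum, Finset.sum_mul, map_sum]
    refine Finset.sum_eq_zero fun B _ => ?_
    have h1 : (monomial B (coeff B t) : MvPolynomial (Fin n) (MvPolynomial (Fin n) K)) *
        MvPolynomial.map (C : K →+* MvPolynomial (Fin n) K) q =
        coeff B t • MvPolynomial.map (C : K →+* MvPolynomial (Fin n) K) (monomial B 1 * q) := by
      rw [map_mul, map_monomial, C_1, ← smul_mul_assoc, smul_monomial, smul_eq_mul, mul_one]
    rw [h1, map_smul, outerNF_map hΦ, normalForm_of_mem (J.mul_mem_left _ (SetLike.mem_coe.mp hq)), map_zero,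
      smul_zero]
  · intro t; rw [mul_zero, map_zero]
  · intro a b _ _ ha hb t; rw [mul_add, map_add, ha t, hb t, add_zero]
  · intro s a _ ha t; rw [smul_eq_mul, ← mul_assoc]; exact ha (t * s)

/-- **The outer normal form preserves `J·S[u]`** (polynomials in `u` with all coefficients in `J`). [folklore] -/
private theorem outerNF_mem_of_mem {F : MvPolynomial (Fin n) (MvPolynomial (Fin n) K)}
    (hF : F ∈ J.map (C : MvPolynomial (Fin n) K →+* MvPolynomial (Fin n) (MvPolynomial (Fin n) K))) :
    Φ F ∈ J.map (C : MvPolynomial (Fin n) K →+* MvPolynomial (Fin n) (MvPolynomial (Fin n) K)) := by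
  rw [outerNF_eq_sum hΦ]
  refine Ideal.sum_mem _ fun A _ => ?_
  rw [smul_eq_C_mul]
  exact Ideal.mul_mem_right _ _ (Ideal.mem_map_of_mem _ (mem_map_C_iff.mp hF A))

end OuterNormalForm

/-! ## 3. The reduced Gröbner generators of the ridge ideal -/

section ReducedGen

variable {m : MonomialOrder (Fin n)} {M : Fin n →₀ ℕ}

/-- A monomial `x^A` seen by `D_A g` on the reduced generator `g = x^M − NF(x^M)` (`coeff_{A+β} g ≠ 0`) with `A ≠ M`
is STANDARD: it divides a standard monomial of `g`, or properly divides `x^M`. [cite: CoxLittleOShea2007, Ch.2 §7 Def. 4] -/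
theorem isStd_of_coeff_add_reducedGen_ne_zero (hM : IsMinLead m (ridgeIdeal I) M) {A β : Fin n →₀ ℕ}
    (h : coeff (A + β) (reducedGen m (ridgeIdeal I) M (k := K)) ≠ 0) (hA : A ≠ M) : IsStd m (ridgeIdeal I) A := by
  by_cases hB : A + β = M
  · exact hM.2 A (by rw [← hB]; exact le_self_add) hA
  · exact (isStd_of_mem_support_reducedGen (mem_support_iff.mpr h) hB).of_le le_self_add

/-- Symmetric form: the `u^β`... — a monomial `x^β` of `D_A g`, `A ≠ 0`, is standard (`β + A` is a monomial of `g`;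
either `β + A = M` and `x^β` properly divides `x^M`, or it is standard). [cite: CoxLittleOShea2007, Ch.2 §7 Def. 4] -/
theorem isReduced_hasseDeriv_reducedGen (hM : IsMinLead m (ridgeIdeal I) M) {A : Fin n →₀ ℕ} (hA : A ≠ 0) :
    IsReduced m (ridgeIdeal I : Set (MvPolynomial (Fin n) K)) (hasseDeriv K A (reducedGen m (ridgeIdeal I) M)) := by
  classical
  intro β hβ
  have h := mem_support_iff.mp hβ
  rw [coeff_hasseDeriv] at h
  have hne : coeff (A + β) (reducedGen m (ridgeIdeal I) M (k := K)) ≠ 0 := fun h0 => h (by rw [h0, mul_zero])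
  by_cases hB : A + β = M
  · refine hM.2 β (by rw [← hB]; exact le_add_self) fun hβM => hA ?_
    have := congrArg Finsupp.degree hB
    rw [map_add, hβM] at this
    exact (Finsupp.degree_eq_zero_iff A).mp (by omega)
  · exact (isStd_of_mem_support_reducedGen (mem_support_iff.mpr hne) hB).of_le le_add_self

/-- **`D_M g = 1`** for the reduced generator `g = x^M − NF(x^M)`: its only monomial divisible by `x^M` is `x^M`
itself, with coefficient `1`. [cite: CoxLittleOShea2007, Ch.2 §7 Def. 4] -/
theorem hasseDeriv_self_reducedGen (hM : IsMinLead m (ridgeIdeal I) M) :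
    hasseDeriv K M (reducedGen m (ridgeIdeal I) M) = 1 := by
  classical
  ext β
  rw [coeff_hasseDeriv, coeff_one]
  by_cases hβ : β = 0
  · subst hβ
    rw [if_pos rfl, add_zero, coeff_reducedGen_self hM.1, mul_one, Finset.prod_eq_one fun i _ => Nat.choose_self _,
      Nat.cast_one]
  · rw [if_neg (fun h => hβ h.symm)]
    by_cases h0 : coeff (M + β) (reducedGen m (ridgeIdeal I) M (k := K)) = 0
    · rw [h0, mul_zero]
    · exfalso
      have hne : M + β ≠ M := fun h => hβ (by simpa using h)
      exact hM.1 ((isStd_of_mem_support_reducedGen (mem_support_iff.mpr h0) hne).of_le le_self_add)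

/-- The Taylor support of the reduced generator: `D_A g ≠ 0` with `A ≠ M` forces `x^A` standard, so `NF(x^A) = x^A`.
[cite: CoxLittleOShea2007, Ch.5 §3 Prop. 1] -/
theorem normalForm_monomial_eq_of_hasseDeriv_reducedGen_ne_zero (hM : IsMinLead m (ridgeIdeal I) M)
    {A : Fin n →₀ ℕ} (hA : A ≠ M) (h : hasseDeriv K A (reducedGen m (ridgeIdeal I) M) ≠ 0) :
    normalForm m (ridgeIdeal I) (monomial A (1 : K)) = monomial A 1 := by
  classical
  obtain ⟨β, hβ⟩ : ∃ β, coeff β (hasseDeriv K A (reducedGen m (ridgeIdeal I) M)) ≠ 0 := by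
    by_contra hcon
    push Not at hcon
    exact h (MvPolynomial.ext _ _ fun β => by rw [hcon β, coeff_zero])
  rw [coeff_hasseDeriv] at hβ
  have hne : coeff (A + β) (reducedGen m (ridgeIdeal I) M (k := K)) ≠ 0 := fun h0 => hβ (by rw [h0, mul_zero])
  exact normalForm_monomial_of_isStd (isStd_of_coeff_add_reducedGen_ne_zero hM hne hA) 1

/-- **The outer normal form of `g(x + u)` is `g(x + u) − g(u)`** for the reduced generator `g`: every `u^A` with
`A ≠ M` in the Taylor expansion is standard, `NF(x^M) = x^M − g`, and `D_M g = 1`. [cite: Giraud1975, §1.5] -/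
private theorem outerNF_taylor_reducedGen
    {Φ : MvPolynomial (Fin n) (MvPolynomial (Fin n) K) →ₗ[MvPolynomial (Fin n) K]
      MvPolynomial (Fin n) (MvPolynomial (Fin n) K)}
    (hΦ : ∀ (A : Fin n →₀ ℕ) (c : MvPolynomial (Fin n) K), Φ (monomial A c) =
      c • MvPolynomial.map (C : K →+* MvPolynomial (Fin n) K) (normalForm m (ridgeIdeal I) (monomial A 1)))
    (hM : IsMinLead m (ridgeIdeal I) M) :
    Φ (taylor K (reducedGen m (ridgeIdeal I) M)) =
      taylor K (reducedGen m (ridgeIdeal I) M) -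
        MvPolynomial.map (C : K →+* MvPolynomial (Fin n) K) (reducedGen m (ridgeIdeal I) M) := by
  classical
  set g := reducedGen m (ridgeIdeal I) M (k := K) with hg
  set τ := taylor K g with hτ
  have hcoeff : ∀ A, coeff A τ = hasseDeriv K A g := fun A => (hasseDeriv_apply K A g).symm
  -- termwise evaluation of the outer normal form on `τ = Σ_A D_A g · u^A`
  have hterm : ∀ A ∈ τ.support,
      coeff A τ • MvPolynomial.map (C : K →+* MvPolynomial (Fin n) K) (normalForm m (ridgeIdeal I) (monomial A 1)) =
        monomial A (coeff A τ) - if A = M then MvPolynomial.map (C : K →+* MvPolynomial (Fin n) K) g else 0 := by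
    intro A hA
    by_cases hAM : A = M
    · rw [if_pos hAM, hAM, hcoeff, hasseDeriv_self_reducedGen hM, one_smul,
        show normalForm m (ridgeIdeal I) (monomial M (1 : K)) = monomial M 1 - g by rw [hg, reducedGen, sub_sub_cancel],
        map_sub, map_monomial, C_1]
    · rw [if_neg hAM, sub_zero, normalForm_monomial_eq_of_hasseDeriv_reducedGen_ne_zero hM hAM
        (by rw [← hcoeff]; exact mem_support_iff.mp hA), map_monomial, C_1, smul_monomial, smul_eq_mul, mul_one]
  rw [outerNF_eq_sum hΦ, Finset.sum_congr rfl hterm, Finset.sum_sub_distrib, ← τ.as_sum, Finset.sum_ite_eq']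
  split_ifs with hMτ
  · rfl
  · -- `M ∉ supp τ` cannot happen (`D_M g = 1`), but the identity holds anyway
    exfalso
    apply mem_support_iff.not.mp hMτ |> fun h => ?_
    have h1 := hcoeff M
    rw [hasseDeriv_self_reducedGen hM] at h1
    exact one_ne_zero (h1 ▸ not_not.mp h)

/-- **Key identity: `D_A g − coeff_A(g) ∈ 𝔉` for every `A`**, for the reduced Gröbner generator `g = x^M − NF(x^M)` of the
ridge ideal at a minimal generator `x^M` of `⟨LT(𝔉)⟩` — the outer normal form of `g(x + u) ∈ 𝔉·S[u] + 𝔉(u)·S[u]` is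
`g(x + u) − g(u) ∈ 𝔉·S[u]`, and its `u^A`-coefficient is `D_A g − coeff_A(g)`. [cite: Giraud1975, §1.5]
[cite: BerthomieuHivertMourtada2010, Lemma 2.6] -/
theorem hasseDeriv_sub_C_coeff_mem (hM : IsMinLead m (ridgeIdeal I) M) (A : Fin n →₀ ℕ) :
    hasseDeriv K A (reducedGen m (ridgeIdeal I) M) - C (coeff A (reducedGen m (ridgeIdeal I) M)) ∈ ridgeIdeal I := by
  have hτ := taylor_mem_of_mem_ridgeIdeal (reducedGen_mem m (ridgeIdeal I) M (k := K))
  obtain ⟨a, ha, b, hb, hab⟩ := Submodule.mem_sup.mp hτ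
  obtain ⟨Φ, hΦ⟩ := exists_outerNF m (ridgeIdeal I)
  have hN : Φ (taylor K (reducedGen m (ridgeIdeal I) M)) ∈
      (ridgeIdeal I).map (C : MvPolynomial (Fin n) K →+* MvPolynomial (Fin n) (MvPolynomial (Fin n) K)) := by
    rw [← hab, map_add, outerNF_eq_zero_of_mem hΦ hb, add_zero]
    exact outerNF_mem_of_mem hΦ ha
  rw [outerNF_taylor_reducedGen hΦ hM] at hN
  have h := mem_map_C_iff.mp hN A
  rwa [coeff_sub, coeff_map, ← hasseDeriv_apply] at h

/-- **The intermediate Hasse–Schmidt derivatives of the reduced Gröbner generators of the ridge ideal vanish**: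
for `I` homogeneous, `g = x^M − NF(x^M)` at a minimal generator `x^M` of `⟨LT(𝔉)⟩`, and `0 < |A| < |M|`: `D_A g = 0`
(`D_A g ∈ 𝔉` is supported on standard monomials, and `coeff_A(g) = 0` by homogeneity). [cite: Giraud1975, Lemme 1.6]
[cite: BerthomieuHivertMourtada2010, Lemma 2.6] -/
theorem hasseDeriv_reducedGen_eq_zero (hI : ∀ f ∈ I, ∀ d : ℕ, homogeneousComponent d f ∈ I)
    (hM : IsMinLead m (ridgeIdeal I) M) {A : Fin n →₀ ℕ} (hA : A ≠ 0) (hAd : A.degree < M.degree) :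
    hasseDeriv K A (reducedGen m (ridgeIdeal I) M) = 0 := by
  have hhom : (reducedGen m (ridgeIdeal I) M (k := K)).IsHomogeneous M.degree :=
    isHomogeneous_reducedGen (fun f hf d => homogeneousComponent_mem_ridgeIdeal hI hf d) M
  have hmem := hasseDeriv_sub_C_coeff_mem hM A (K := K)
  rw [hhom.coeff_eq_zero hAd.ne, C_0, sub_zero] at hmem
  exact eq_zero_of_mem_of_isReduced hmem (isReduced_hasseDeriv_reducedGen hM hA)

/-- **The reduced Gröbner generators of the ridge ideal are additive `p`-forms**: for `I` homogeneous over a field of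
exponential characteristic `p` and `x^M` a minimal generator of `⟨LT(𝔉)⟩`, `x^M − NF(x^M) = Σ_k c_k X_k^{p^e}` with
`|M| = p^e`. [cite: Giraud1975, §1.5] [cite: BerthomieuHivertMourtada2010, Lemma 2.7] -/
theorem exists_reducedGen_eq_sum_C_mul_X_pow (p : ℕ) [ExpChar K p]
    (hI : ∀ f ∈ I, ∀ d : ℕ, homogeneousComponent d f ∈ I) (hM : IsMinLead m (ridgeIdeal I) M) :
    ∃ (e : ℕ) (c : Fin n → K), M.degree = p ^ e ∧
      reducedGen m (ridgeIdeal I) M = ∑ k, C (c k) * X k ^ p ^ e := by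
  classical
  have hhom : (reducedGen m (ridgeIdeal I) M (k := K)).IsHomogeneous M.degree :=
    isHomogeneous_reducedGen (fun f hf d => homogeneousComponent_mem_ridgeIdeal hI hf d) M
  have hM0 : M ≠ 0 := by
    rintro rfl
    exact hM.1 (isStd_zero m (ridgeIdeal_ne_top I))
  have hd : 1 ≤ M.degree := by
    rw [Nat.one_le_iff_ne_zero, Ne, Finsupp.degree_eq_zero_iff]
    exact hM0
  exact exists_eq_sum_C_mul_X_pow_of_hasseDeriv_eq_zero p hhom hd (reducedGen_ne_zero hM.1)
    fun A hA hAd => hasseDeriv_reducedGen_eq_zero hI hM hA hAd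

/-- The reduced Gröbner generators of the ridge ideal are among its additive homogeneous forms `ridgeForm p I`.
[cite: Giraud1975, §1.5] -/
theorem exists_reducedGen_eq_ridgeForm (p : ℕ) [ExpChar K p]
    (hI : ∀ f ∈ I, ∀ d : ℕ, homogeneousComponent d f ∈ I) (hM : IsMinLead m (ridgeIdeal I) M) :
    ∃ j : RidgeFormIndex p I, reducedGen m (ridgeIdeal I) M = ridgeForm p I j := by
  obtain ⟨e, c, -, hg⟩ := exists_reducedGen_eq_sum_C_mul_X_pow p hI hM
  have hmem : (∑ k, C (c k) * X k ^ p ^ e : MvPolynomial (Fin n) K) ∈ ridgeIdeal I :=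
    hg ▸ reducedGen_mem m (ridgeIdeal I) M
  exact ⟨⟨(c, e), hmem⟩, hg⟩

end ReducedGen

/-! ## 4. Giraud's structure theorem -/

section Structure

/-- **Giraud's structure theorem (named fact `RidgeIdealSpanAdditive`): for a homogeneous ideal `I` over a field
`K` of exponential characteristic `p`, the ideal of the ridge of the cone `V(I)` is generated by the additive
homogeneous `p`-forms `Σ_k c_k X_k^{p^e}` it contains** ("`F` admet pour équations des polynômes additifs
homogènes"). [cite: Giraud1975, §1.5] [cite: BerthomieuHivertMourtada2010, Lemma 2.7] -/
theorem ridgeIdealSpanAdditive_of_isHomogeneous (p : ℕ) [ExpChar K p]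
    (hI : ∀ f ∈ I, ∀ d : ℕ, homogeneousComponent d f ∈ I) : RidgeIdealSpanAdditive p I := by
  unfold RidgeIdealSpanAdditive
  refine le_antisymm ?_ (Ideal.span_le.mpr ?_)
  · refine le_of_forall_reducedGen_mem (m := MonomialOrder.lex) fun M hM => ?_
    obtain ⟨j, hj⟩ := exists_reducedGen_eq_ridgeForm p hI hM
    rw [hj]
    exact Ideal.subset_span ⟨j, rfl⟩
  · rintro _ ⟨j, rfl⟩
    exact ridgeForm_mem_ridgeIdeal j

/-- **Prime characteristic form.** [cite: Giraud1975, §1.5] -/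
theorem ridgeIdealSpanAdditive_of_charP (p : ℕ) [Fact p.Prime] [CharP K p]
    (hI : ∀ f ∈ I, ∀ d : ℕ, homogeneousComponent d f ∈ I) : RidgeIdealSpanAdditive p I :=
  haveI : ExpChar K p := ExpChar.prime Fact.out
  ridgeIdealSpanAdditive_of_isHomogeneous p hI

/-- **Characteristic zero form** (`p = 1`: the ridge ideal is generated by LINEAR forms, i.e. ridge = directrix).
[cite: Schober2021IdealisticExponents, Rem. 2.6] -/
theorem ridgeIdealSpanAdditive_of_charZero [CharZero K]
    (hI : ∀ f ∈ I, ∀ d : ℕ, homogeneousComponent d f ∈ I) : RidgeIdealSpanAdditive 1 I :=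
  haveI : ExpChar K 1 := ExpChar.zero
  ridgeIdealSpanAdditive_of_isHomogeneous 1 hI

/-- **Index-free form: the ideal of the ridge is generated by its ADDITIVE HOMOGENEOUS elements** (BHM Lemma 2.7 /
Cor. 2.12: `𝔉 = (𝔉 ∩ U) S` with `U` the algebra of the additive forms of `𝔉`), for `I` homogeneous over any field.
[cite: BerthomieuHivertMourtada2010, Cor. 2.12] -/
theorem ridgeIdeal_eq_span_isAdditive (hI : ∀ f ∈ I, ∀ d : ℕ, homogeneousComponent d f ∈ I) :
    ridgeIdeal I = Ideal.span {θ | θ ∈ ridgeIdeal I ∧ IsAdditive θ ∧ ∃ q : ℕ, θ.IsHomogeneous q} := by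
  obtain ⟨p, hp⟩ := ExpChar.exists K
  refine le_antisymm ?_ (Ideal.span_le.mpr fun θ hθ => hθ.1)
  have h := ridgeIdealSpanAdditive_of_isHomogeneous p hI
  unfold RidgeIdealSpanAdditive at h
  refine h.le.trans (Ideal.span_mono ?_)
  rintro _ ⟨j, rfl⟩
  refine ⟨ridgeForm_mem_ridgeIdeal j, ?_, p ^ j.1.2, ?_⟩
  · -- `Σ c_k X_k^{p^e}` is additive
    have hq : ringExpChar K = p := ringExpChar.eq K p
    refine isAdditive_of_mem_span_X_pow j.1.2 ?_
    rw [hq, ridgeForm]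
    refine Submodule.sum_mem _ fun k _ => ?_
    rw [← smul_eq_C_mul]
    exact Submodule.smul_mem _ _ (Submodule.subset_span ⟨k, rfl⟩)
  · rw [ridgeForm]
    exact IsHomogeneous.sum _ _ _ fun k _ => (isHomogeneous_X_pow _ _).C_mul _

end Structure

end Literature.AlgebraicGeometry.Resolution

end
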